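import Mathlib
import HarnessLib.Audit
import Summits.PneNP.PneNP.Theorems.PstarFreeMonomial

/-!
# Half-free monomials of a terminal core: the POISON RULE for exact-menu certificates (ROUND-24, O1; memo g24 §35.4)

FRONTIER range-avoidance ladder, rung F-N3, ROUND 24 (cell `pnp-ideate`, prover-2 memo `g24/O1-NOFREEVERTEX-g24.md` §35; typed targets
`PstarCoreBoundTargets.TerminalFive` / `TerminalPeelable` (p646951); restricted-model proof complexity — nothing here bears on `P` versus `NP`).

A monomial `g` of the readers of a terminal core `(K; Γ₁, Γ₂)` is HALF-FREE at its AND variable `π` when `π` occurs in no output of `K` and in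
no other monomial of `Γ₁, Γ₂` (linear reads allowed; nothing is asked of the other AND variable `σ`).  Flipping `x_π` keeps `Sol(K)` and moves
`Γ_k` by the MOVE `δ_k(x) = [g ∈ G_k]·x_σ ⊕ [π ∈ C_k]` (`gval_flip_halfFree`).  (T3) therefore gives:

* **`move_eq_false_of_halfFree`** — at a solution of the core where `Γ₁` is on target and `δ₁ = 0`, also `δ₂ = 0`;
* **`sigma_eq_of_halfFree`** — the census form: if `g ∈ G₂ ∖ G₁` and `π ∉ C₁`, then on `Sol(K) ∩ {Γ₁ = b₁}` the variable `x_σ` is CONSTANT,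
  equal to `[π ∈ C₂]`.

USE (exact-menu census, `PstarMenuCriterion.MenuCriterionBound`): in an exact certificate `(K₀; d₁, d₂)` the second reader carries a whole channel
menu; every gate `(σ, π)` of that menu on a chord outside `K₀` and the folds is half-free at `π`, so the certificate survives only if `σ` is
forced on `Sol(K₀) ∩ {d₁ = b₁}` — a one-line test that kills the foreign gates of p3's `J₀(m)` family (memo §35.4).  Complements
`PstarFreeMonomial.false_of_free_monomial` (both AND variables private).
-/

set_option linter.dupNamespace false -- `Summit.PneNP.PneNP.…`: summit = sub-problem name (D-0017 single-conjunct layout)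

open Finset Literature.Computability.Complexity
open Summit.PneNP.PneNP.Theorems.PstarTyped (Typed)
open Summit.PneNP.PneNP.Theorems.PstarSALevel (varSet bdry BoundaryExpanding SimpleOverlap)
open Summit.PneNP.PneNP.Theorems.PstarGapOneAll (gval)
open Summit.PneNP.PneNP.Theorems.PstarGConstraint (gval_update_of_forall_ne)
open Summit.PneNP.PneNP.Theorems.PstarCoreBoundTargets (Terminal)
open Summit.PneNP.PneNP.Theorems.PstarChordReadSwitch (solves_update_of_outside)
open Summit.PneNP.PneNP.Theorems.PstarFreeMonomial (Q gval_split_free)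

namespace Summit.PneNP.PneNP.Theorems.PstarHalfFreeGate

variable {n m : ℕ}

/-! ## The move of a half-free monomial -/
section Move

variable (I : LocalMap 4 n m)

/-- **Flipping the free variable `π` of a half-free monomial `g = (σ, π)` moves the reader by `[g ∈ G]·x_σ ⊕ [π ∈ C]`.** -/
theorem gval_flip_halfFree (hI : I.IsPure xorAndPred) (C : Finset (Fin n)) (G : Finset (Fin m)) {g : Fin m} {σ π : Fin n}
    (hslots : (I.vars g 2 = σ ∧ I.vars g 3 = π) ∨ (I.vars g 2 = π ∧ I.vars g 3 = σ))
    (hπG : ∀ g' ∈ G, g' ≠ g → I.vars g' 2 ≠ π ∧ I.vars g' 3 ≠ π) (x : Fin n → Bool) :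
    gval I C G (Function.update x π (!x π)) = xor (gval I C G x) (xor (decide (g ∈ G) && x σ) (decide (π ∈ C))) := by
  classical
  have hpq : I.vars g 2 ≠ I.vars g 3 := fun e => absurd (hI.2 g e) (by decide)
  have hσπ : σ ≠ π := by
    rcases hslots with ⟨h2, h3⟩ | ⟨h2, h3⟩
    · rw [← h2, ← h3]; exact hpq
    · rw [← h2, ← h3]; exact hpq.symm
  -- the reduced reader does not see `π`
  have hπC : π ∉ (C.erase (I.vars g 2)).erase (I.vars g 3) := by
    rcases hslots with ⟨-, h3⟩ | ⟨h2, -⟩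
    · rw [h3]; exact notMem_erase π _
    · rw [h2]; exact fun h => notMem_erase π C (mem_of_mem_erase h)
  have hπG' : ∀ g' ∈ G.erase g, I.vars g' 2 ≠ π ∧ I.vars g' 3 ≠ π := fun g' hg' => hπG g' (mem_of_mem_erase hg') (ne_of_mem_erase hg')
  have hR : gval I ((C.erase (I.vars g 2)).erase (I.vars g 3)) (G.erase g) (Function.update x π (!x π)) =
      gval I ((C.erase (I.vars g 2)).erase (I.vars g 3)) (G.erase g) x := gval_update_of_forall_ne I x hπC hπG' _
  rw [gval_split_free I hI C G g (Function.update x π (!x π)), gval_split_free I hI C G g x, hR]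
  rcases hslots with ⟨h2, h3⟩ | ⟨h2, h3⟩
  · rw [h2, h3, Function.update_self, Function.update_of_ne hσπ]
    unfold Q
    cases gval I ((C.erase σ).erase π) (G.erase g) x <;> cases decide (g ∈ G) <;> cases decide (σ ∈ C) <;> cases decide (π ∈ C) <;>
      cases x σ <;> cases x π <;> decide
  · rw [h2, h3, Function.update_self, Function.update_of_ne hσπ]
    unfold Q
    cases gval I ((C.erase π).erase σ) (G.erase g) x <;> cases decide (g ∈ G) <;> cases decide (σ ∈ C) <;> cases decide (π ∈ C) <;>
      cases x σ <;> cases x π <;> decide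

end Move

/-! ## The poison rule -/
section Main

variable {I : LocalMap 4 n m} {r : ℕ} {y : Fin m → Bool} {K : Finset (Fin m)} {w₁ w₂ : Finset (Fin n) × Finset (Fin m) × Bool} {g : Fin m}
  {σ π : Fin n}

/-- **THE MOVES OF A HALF-FREE MONOMIAL VANISH TOGETHER.**  `(K, w₁, w₂)` terminal; `g` a monomial with AND variables `σ, π`, `π` in no output of `K`
and in no other monomial of `G₁ ∪ G₂`.  At a solution `x` of the core with `Γ₁(x) = b₁` and `δ₁(x) = [g ∈ G₁]·x_σ ⊕ [π ∈ C₁] = 0`, also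
`δ₂(x) = [g ∈ G₂]·x_σ ⊕ [π ∈ C₂] = 0` (else flipping `x_π` puts both readers on target inside `Sol(K)`, against (T3)). -/
theorem move_eq_false_of_halfFree (hI : I.IsPure xorAndPred) (ht : Terminal I r y K w₁ w₂)
    (hslots : (I.vars g 2 = σ ∧ I.vars g 3 = π) ∨ (I.vars g 2 = π ∧ I.vars g 3 = σ)) (hπK : ∀ j ∈ K, π ∉ varSet I j)
    (hπG : ∀ g' ∈ w₁.2.1 ∪ w₂.2.1, g' ≠ g → I.vars g' 2 ≠ π ∧ I.vars g' 3 ≠ π)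
    {x : Fin n → Bool} (hx : ∀ j ∈ K, I.eval x j = y j) (hx₁ : gval I w₁.1 w₁.2.1 x = w₁.2.2)
    (hδ₁ : xor (decide (g ∈ w₁.2.1) && x σ) (decide (π ∈ w₁.1)) = false) :
    xor (decide (g ∈ w₂.2.1) && x σ) (decide (π ∈ w₂.1)) = false := by
  by_contra hδ₂
  have T := fun (z : Fin n → Bool) (hz : ∀ j ∈ K, I.eval z j = y j) (a : gval I w₁.1 w₁.2.1 z = w₁.2.2)
    (b : gval I w₂.1 w₂.2.1 z = w₂.2.2) => ht.2.2.2.2.2.2.1 ⟨z, hz, a, b⟩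
  have hx' : ∀ j ∈ K, I.eval (Function.update x π (!x π)) j = y j := solves_update_of_outside hπK hx _
  have e₁ := gval_flip_halfFree I hI w₁.1 w₁.2.1 hslots (fun g' hg' => hπG g' (mem_union_left _ hg')) x
  have e₂ := gval_flip_halfFree I hI w₂.1 w₂.2.1 hslots (fun g' hg' => hπG g' (mem_union_right _ hg')) x
  rw [hδ₁, hx₁, Bool.xor_false] at e₁
  by_cases hx₂ : gval I w₂.1 w₂.2.1 x = w₂.2.2
  · exact T x hx hx₁ hx₂
  · refine T _ hx' e₁ ?_
    rw [e₂]
    revert hx₂ hδ₂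
    cases gval I w₂.1 w₂.2.1 x <;> cases w₂.2.2 <;> cases (xor (decide (g ∈ w₂.2.1) && x σ) (decide (π ∈ w₂.1))) <;> decide

/-- **POISON RULE (census form).**  If the half-free monomial `g = (σ, π)` lies in `G₂` but not in `G₁`, and `π ∉ C₁`, then on
`Sol(K) ∩ {Γ₁ = b₁}` the variable `x_σ` is constant, equal to `[π ∈ C₂]`. -/
theorem sigma_eq_of_halfFree (hI : I.IsPure xorAndPred) (ht : Terminal I r y K w₁ w₂)
    (hslots : (I.vars g 2 = σ ∧ I.vars g 3 = π) ∨ (I.vars g 2 = π ∧ I.vars g 3 = σ)) (hg₂ : g ∈ w₂.2.1) (hg₁ : g ∉ w₁.2.1)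
    (hπK : ∀ j ∈ K, π ∉ varSet I j) (hπG : ∀ g' ∈ w₁.2.1 ∪ w₂.2.1, g' ≠ g → I.vars g' 2 ≠ π ∧ I.vars g' 3 ≠ π) (hπC₁ : π ∉ w₁.1)
    {x : Fin n → Bool} (hx : ∀ j ∈ K, I.eval x j = y j) (hx₁ : gval I w₁.1 w₁.2.1 x = w₁.2.2) : x σ = decide (π ∈ w₂.1) := by
  have h := move_eq_false_of_halfFree hI ht hslots hπK hπG hx hx₁ (by rw [decide_eq_false hg₁, decide_eq_false hπC₁]; rfl)
  rw [decide_eq_true hg₂, Bool.true_and] at h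
  revert h
  cases x σ <;> cases decide (π ∈ w₂.1) <;> decide

/-- The same with the roles of the two readers exchanged. -/
theorem sigma_eq_of_halfFree' (hI : I.IsPure xorAndPred) (ht : Terminal I r y K w₁ w₂)
    (hslots : (I.vars g 2 = σ ∧ I.vars g 3 = π) ∨ (I.vars g 2 = π ∧ I.vars g 3 = σ)) (hg₁ : g ∈ w₁.2.1) (hg₂ : g ∉ w₂.2.1)
    (hπK : ∀ j ∈ K, π ∉ varSet I j) (hπG : ∀ g' ∈ w₁.2.1 ∪ w₂.2.1, g' ≠ g → I.vars g' 2 ≠ π ∧ I.vars g' 3 ≠ π) (hπC₂ : π ∉ w₂.1)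
    {x : Fin n → Bool} (hx : ∀ j ∈ K, I.eval x j = y j) (hx₂ : gval I w₂.1 w₂.2.1 x = w₂.2.2) : x σ = decide (π ∈ w₁.1) := by
  -- the terminal core with the readers swapped
  have ht' : Terminal I r y K w₂ w₁ := by
    obtain ⟨hne, hX, hKr, hd₁, hd₂, hr, hT3, hM0⟩ := ht
    refine ⟨hne, hX, hKr, hd₂, hd₁, ?_, ?_, fun f hf => ?_⟩
    · rw [union_right_comm]; exact hr
    · rintro ⟨z, hz, a, b⟩; exact hT3 ⟨z, hz, b, a⟩
    · obtain ⟨z, hz, a, b⟩ := hM0 f hf; exact ⟨z, hz, b, a⟩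
  exact sigma_eq_of_halfFree hI ht' hslots hg₁ hg₂ hπK (fun g' hg' => hπG g' (by rw [union_comm]; exact hg')) hπC₂ hx hx₂

end Main

end Summit.PneNP.PneNP.Theorems.PstarHalfFreeGate
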